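import Summits.ValiantsHypothesis.ValiantsHypothesis.Theses.ProjectionStability
import Summits.ValiantsHypothesis.ValiantsHypothesis.Theorems.ProjectionRigidityProjOptimalUniqueRefutation
import Literature.Computability.AlgebraicComplexity.GrenetProjection

/-!
# Refutation of `ProjectionStability.UniqBase` (stmt-ValiantsHypothesis-17836)

Route `ValiantsHypothesis/ProjectionStability` posits as its FINITE BASE (`UniqBase`, crux, rank 4)
that any two PURE projections `A, B` of `DET` (every cell a variable `X v` or a constant `C c`) of the
optimal size `m = pdc(per₃)` with `det A = det B = per₃` satisfy `B = P·A(γx)·Q` or `B = P·A(γx)ᵀ·Q`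
with constant `P, Q ∈ GL_m(ℂ)` and `γ ∈ permSymmetrySubst ℂ 3`.

This is, verbatim, the `n = 3` instance of the parent route's `ProjectionRigidity.ProjOptimalUnique`;
rewriting `pdc(per₃) = 7` (tree: `Literature…detProjectionComplexity_perPoly_three`, Alper–Bogart–Velasco
2017 Cor. 1.4 with Grenet 2011) turns it into `ProjectionRigidity.ProjOptimalUniqueThree`
(stmt-ValiantsHypothesis-16004), which the tree refutes (`Theorems.not_ProjOptimalUniqueThree`,
file `Theorems/ProjectionRigidityProjOptimalUniqueRefutation.lean`).

Witness (tree, `Theorems/ProjOptimalUnique/Negative/PurifiedTwist.lean`, `exists_grenet_purifiedTwist`):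
Grenet's `7 × 7` projection `gA` of `per₃` and its PURIFIED single-syzygy Koszul twist
`K = P₀ · gA · (1 + D) · Q₀`, a `{0, ±1, X}`-valued pure `7 × 7` projection with `det K = per₃`:
```
K = !![X00, X00, X10, X20, 0,   1,   X22;
       X21, X00, X10, X20, 1,   X01, X12;
       X10, -1,  X21, 0,   X21, X11, X02;
       X11, 0,   X01, -1,  X01, 1,   X22;
       1,   0,   0,   0,   0,   0,   X02;
       0,   0,   1,   0,   1,   0,   X12;
       0,   0,   0,   0,   0,   1,   X22]
```
Separating invariant: six variables of `gA` have a coefficient matrix supported in one row (rank ≤ 1),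
while five variables of `K` have a coefficient matrix with an invertible `2 × 2` minor and pairwise
private cells; realised symmetries `γ ∈ permSymmetrySubst ℂ 3` are monomial, so constant gauge and
transposition preserve "rank ≤ 1" of the (relabelled, rescaled) coefficient matrices — pigeonhole on the
five big variables of `K` against the three column-`1` variables of `gA` gives the contradiction.

Classification (for the planner): `refuted-substantive`.  The witness is an honest optimal pure
projection with integer constants `0, ±1` at the only certified level `n = 3`: purity, optimal size
`pdc(per₃) = 7` and the full symmetry group `GL₇(ℂ)² × permSymmetrySubst × ᵀ` are all granted, so no
missing side condition or degenerate case is exploited; the route's own kill criterion ("a second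
`GL² × G_per × ᵀ`-orbit of `7 × 7` projections of `per₃`") is met verbatim.  No cheap repair: the twist
is a row syzygy of Grenet_n present at every `n` (not visibly sporadic), restating the base at
`n₀ = 4` is uncertifiable (`pdc(per₄)` open), and uniqueness modulo POLYNOMIAL gauge is vacuous
(`ℂ[x]/(per₃)` is factorial).  Inside the route, `BootstrapAtThree` (stmt-17837) and the `n = 3`
instances of `UniqStep` / `OptStep` become vacuous.  The same negation was recorded earlier as a
by-product in `Theorems/UniqStep/Negative/NotHalfEqThree.lean` (`UniqStep.Negative.not_uniqBase`);
this file is the item's canonical refutation target and depends only on the parent refutation.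
-/

-- single-conjunct layout: Sub = Summit, duplicated namespace component intended
set_option linter.dupNamespace false

namespace Summit.ValiantsHypothesis.ValiantsHypothesis.Theorems

open Literature.Computability.AlgebraicComplexity
open Summit.ValiantsHypothesis.ValiantsHypothesis.Theses

/-- `ProjectionStability.UniqBase` is literally `ProjectionRigidity.ProjOptimalUniqueThree` once
`pdc(per₃) = 7` (Alper–Bogart–Velasco 2017 Cor. 1.4 + Grenet 2011; tree
`detProjectionComplexity_perPoly_three`) is rewritten. [folklore] -/
theorem uniqBase_iff_projOptimalUniqueThree :
    ProjectionStability.UniqBase ↔ ProjectionRigidity.ProjOptimalUniqueThree := by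
  unfold ProjectionStability.UniqBase ProjectionRigidity.ProjOptimalUniqueThree
  rw [detProjectionComplexity_perPoly_three]

/-- Refutes `ProjectionStability.UniqBase` (stmt-ValiantsHypothesis-17836), `refuted-substantive`:
Grenet's `7 × 7` projection of `per₃` and its purified single-syzygy Koszul twist `K` (constants
`0, ±1`; tree `exists_grenet_purifiedTwist`) are two optimal pure projections of `DET` with determinant
`per₃` in different `GL₇(ℂ) × GL₇(ℂ) × permSymmetrySubst ℂ 3 × ᵀ` classes (tree
`not_ProjOptimalUniqueThree`), transported along `pdc(per₃) = 7`.  No cheap repair (the twist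
mechanism is a row syzygy of Grenet_n at every `n`; polynomial-gauge uniqueness is vacuous). [folklore] -/
theorem not_UniqBase : ¬ ProjectionStability.UniqBase := fun h =>
  not_ProjOptimalUniqueThree (uniqBase_iff_projOptimalUniqueThree.mp h)

end Summit.ValiantsHypothesis.ValiantsHypothesis.Theorems
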